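import Literature.NumberTheory.LFunctions.KMVAfeWeightDecay
import Literature.NumberTheory.LFunctions.KMVCutoffWAfeWBridge
import Literature.NumberTheory.LFunctions.KMVCentralValueSquaredAFEHead
import Literature.NumberTheory.LFunctions.KMVDerivLambdaIntegral
import Literature.NumberTheory.LFunctions.KMVAfeWeightRealForm
import Literature.NumberTheory.LFunctions.KMVAfeLogSeries
import Literature.NumberTheory.LFunctions.KMVLogCutoffWBound
import Literature.NumberTheory.EllipticCurves.CuspFormFrickeAxisIntegral
import Literature.NumberTheory.EllipticCurves.PAdicLFunctionNonvanishingProofs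
import Literature.NumberTheory.EllipticCurves.CuspFormLFunctionNewformFrickeProofs
import HarnessLib

/-!
# FACT SKELETON `log-fricke-split` (v2: ALL FIVE STUBS DISCHARGED BY NAME, 0 sorry) for H-AFE2 =
# `Literature.NumberTheory.LFunctions.KMV2000.kmv2000_eq22` (KMV 2000 (21)–(22), ALL orders `k`)
# and for the decay statement `Literature.NumberTheory.LFunctions.KMV2000.afeW_decay`

Cell landau-siegel / ls-inputs, seat ls-inputs-Hafe-lead g1 (K-INPUTS-11 (1)); card
`ls-inputs/Hafe2/Lines/log-fricke-split.md`. Targets (both typed in the tree):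

  `kmv2000_eq22 : ∀ q prime, ∀ f ∈ newforms0 q 2, ∀ k,
     Summable ‖afeTerm q f k k ·‖ ∧ Λ^{(k)}(f,½)² = 2 q̂ Σ'_{ℕ×ℕ} afeTerm q f k k n₁ n₂`
  (`afeTerm = λ_f(n₁)λ_f(n₂)(n₁n₂)^{-1/2} afeW q̂ k k n₁ n₂`, `afeW` = the Mellin–Barnes weight on `Re t = 3`),
  `afeW_decay : ∀ i j A ≥ 0, ∃ C, ∀ q̂ > 0, n₁ n₂ ≥ 1, ‖afeW q̂ i j n₁ n₂‖ ≤ C (q̂²/n₁n₂)^A (1+|log q̂/n₁|)^i (1+|log q̂/n₂|)^j`.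

MECHANISM (real-variable, the `k = 0` line `fricke-real-split` of g0 with log weights). Write
`G_k(y) = f(iy)·(log(√N y))^k`, `A_k = ∫_0^∞ G_k`, `H_k(y) = ∫_0^y G_k`, `T_k(y) = ∫_{v > 1/(Ny)} G_k(v) dv`.
* T1  `G_k ∈ L¹(0,∞)` and `Λ^{(k)}(f,½) = 2π q̂^{1/2} A_k`   (k-th derivative under the Mellin integral).
* T2  Fricke on the axis with log weight: `T_k(y) = (−1)^k (−ε) H_k(y)`   (`v = 1/(Nu)`: `log √N v = −log √N u`).
* T3  REAL-FORM BRIDGE `afeW q̂ i j n₁ n₂ = W_{ij}(log q̂/n₁, log q̂/n₂; n₁n₂/q̂²)`, `W_{ij} = logCutoffW i j`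
      (`D_i(q̂;n,t) = (q̂/n)ᵗ ∫ e^{−x}(log q̂/n + log x)^i xᵗ dx`; Mellin inversion on `Re t = 3`).
* T4  series side: `HasSum (λλ(n₁n₂)^{-1/2} W_{kk}(…; n₁n₂/q̂²)) (4π² ∫_0^∞ G_k·T_k)`   (q-expansion twice).
* T5  Rankin bound `|W_{ij}(a₁,a₂;y)| ≤ C y^{−A} (1+|a₁|)^i (1+|a₂|)^j` (every `A ≥ 0`).
* head `∫_0^∞ G_k H_k = A_k²/2` = tree `KMV2000.integral_Ioi_mul_integral_Ioc_eq_sq_div_two` (no stub).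
* composition: `Σ afeTerm = 4π²(−1)^{k+1} ε A_k²/2`; `A_k = (1 + (−1)^{k+1}ε)·∫_0^{1/√N} G_k` (T2 at `y = 1/√N`),
  `ε² = 1` ⇒ `(−1)^{k+1} ε A_k² = A_k²` ⇒ `2q̂ Σ = 4π² q̂ A_k² = Λ^{(k)}(f,½)²`; `‖afeW‖ = |W_{ij}| ≤ …` (T3 + T5).
The compositions `kmv2000_eq22_of` / `afeW_decay_of` are real proofs; `sorry` only in `stub_*`.

v2 (2026-08-28T13:10Z, lead g1): the five stubs are the LANDED theorems, by name —
T1 `KMV2000.derivLambda_eq_integral_all` (p635387, KMVDerivLambdaIntegral), T2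
`IsFrickeEigen.integral_imagAxis_Ioi_inv_mul_logPow_all` (p635008, CuspFormFrickeAxisIntegral), T3
`KMV2000.afeW_eq_logCutoffW_all` (p632667, KMVAfeWeightRealForm), T4 `KMV2000.hasSum_logCutoffW_all` (p634743,
KMVAfeLogSeries), T5 `KMV2000.logCutoffW_bound_all` (p633229, KMVLogCutoffWBound); statements byte-identical to v1
(058098c352f579d0). The closing Literature file is `KMVExactAFEAllOrdersProofs` (`kmv2000_eq22_holds`,
`afeW_decay_holds`).
-/

noncomputable section

open scoped Real
open Complex Set MeasureTheory Filter CongruenceSubgroup UpperHalfPlane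
open Literature.NumberTheory.EllipticCurves.ModularForms
open Literature.NumberTheory.LFunctions

namespace Literature.NumberTheory.LFunctions.KMV2000.LogFrickeSplit

/-! ## Stubs (registered signatures) -/

/-- **T1** `G_k = f(iy)(log √N y)^k ∈ L¹(0,∞)` and `Λ^{(k)}(f,½) = 2π q̂^{1/2} ∫_0^∞ f(iy)(log(√N y))^k dy`
(KMV p. 1: `Λ(f,s) = q̂ˢΓ(s+½)L(f,s) = (2π)^{1/2} N^{s/2} ∫_0^∞ f(iy) y^{s−1/2} dy`; differentiate `k` times under
the Mellin integral — tree `iteratedDeriv_mellin_eq_of_isBigO_rpow`, two-sided decay `isBigO_imagAxis_nhdsGT_zero`). -/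
theorem stub_derivLambda_eq_integral :
    ∀ (N : ℕ) [NeZero N] (f : CuspForm (Gamma0 N) 2) (k : ℕ),
      IntegrableOn (fun y : ℝ ↦ f (UpperHalfPlane.ofComplex (Complex.I * y)) *
          (((Real.log (Real.sqrt N * y)) ^ k : ℝ) : ℂ)) (Ioi 0) ∧
      KMV2000.derivLambda N k f =
        2 * (π : ℂ) * ((KMV2000.qhat N : ℝ) : ℂ) ^ (1 / 2 : ℂ) *
          ∫ y in Ioi (0 : ℝ), f (UpperHalfPlane.ofComplex (Complex.I * y)) *
            (((Real.log (Real.sqrt N * y)) ^ k : ℝ) : ℂ) :=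
  KMV2000.derivLambda_eq_integral_all

/-- **T2** Fricke symmetry on the imaginary axis with the log weight: for `f(-1/(Nτ)) = ε N τ² f(τ)`,
`y > 0`: `∫_{v > 1/(Ny)} f(iv)(log √N v)^k dv = (−1)^k (−ε) ∫_{0 < u ≤ y} f(iu)(log √N u)^k du`
(substitution `v = 1/(Nu)`, `log(√N/(Nu)) = −log(√N u)`; `k = 0` is the tree's
`IsFrickeEigen.integral_imagAxis_Ioi_inv_mul`). -/
theorem stub_fricke_tail_log :
    ∀ (N : ℕ) [NeZero N] (f : CuspForm (Gamma0 N) 2) (ε : ℂ), IsFrickeEigen N f ε →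
      ∀ (k : ℕ) (y : ℝ), 0 < y →
        ∫ v in Ioi (((N : ℝ) * y)⁻¹), f (UpperHalfPlane.ofComplex (Complex.I * v)) *
            (((Real.log (Real.sqrt N * v)) ^ k : ℝ) : ℂ) =
          (-1) ^ k * (-ε) * ∫ u in Ioc (0 : ℝ) y, f (UpperHalfPlane.ofComplex (Complex.I * u)) *
            (((Real.log (Real.sqrt N * u)) ^ k : ℝ) : ℂ) :=
  IsFrickeEigen.integral_imagAxis_Ioi_inv_mul_logPow_all

/-- **T3** the REAL-FORM BRIDGE: for `q̂ > 0`, `n₁, n₂ ≥ 1` and all orders `i, j`,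
`afeW q̂ i j n₁ n₂ = W_{ij}(log(q̂/n₁), log(q̂/n₂); n₁n₂/q̂²)` with `W_{ij} = KMV2000.logCutoffW i j`
(`D_i(q̂;n,t) = (q̂/n)ᵗ∫_0^∞ e^{−x}(log(q̂/n)+log x)^i xᵗ dx`, `𝓜[W_{ij}(a₁,a₂;·)](t) = M_i(a₁,t)M_j(a₂,t)/t`,
Mellin inversion on `Re t = 3`; `i = j = 0` is the tree's `afeW_zero_zero_eq_cutoffW`). -/
theorem stub_afeW_eq_logCutoffW :
    ∀ (qh : ℝ), 0 < qh → ∀ (i j n₁ n₂ : ℕ), n₁ ≠ 0 → n₂ ≠ 0 →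
      KMV2000.afeW qh i j n₁ n₂ =
        ((KMV2000.logCutoffW i j (Real.log (qh / n₁)) (Real.log (qh / n₂))
          ((n₁ : ℝ) * n₂ / qh ^ 2) : ℝ) : ℂ) :=
  KMV2000.afeW_eq_logCutoffW_all

/-- **T4** the series side in real form: for `f ∈ S₂(Γ₀(N))` and every `k`,
`Σ_{(n₁,n₂)∈ℕ×ℕ} λ_f(n₁)λ_f(n₂)(n₁n₂)^{−1/2} W_{kk}(log(q̂/n₁), log(q̂/n₂); n₁n₂/q̂²)
 = 4π² ∫_0^∞ G_k(y) (∫_{v > 1/(Ny)} G_k(v) dv) dy` as a `HasSum` (`q̂ = √N/2π`; q-expansion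
`f(iy) = Σ a_n e^{−2πny}` twice, `x₁ = 2πn₁y`, `x₂ = 2πn₂v`, `q̂x₁/n₁ = √N y`; domination by Rankin's trick). -/
theorem stub_hasSum_logCutoffW :
    ∀ (N : ℕ) [NeZero N] (f : CuspForm (Gamma0 N) 2) (k : ℕ),
      HasSum (fun n : ℕ × ℕ ↦ GL2Family.heckeLambda f n.1 * GL2Family.heckeLambda f n.2 *
          ((((n.1 : ℝ) * n.2) ^ (-(1 / 2 : ℝ)) : ℝ) : ℂ) *
          ((KMV2000.logCutoffW k k (Real.log (KMV2000.qhat N / n.1)) (Real.log (KMV2000.qhat N / n.2))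
            ((n.1 : ℝ) * n.2 / KMV2000.qhat N ^ 2) : ℝ) : ℂ))
        (4 * (π : ℂ) ^ 2 *
          ∫ y in Ioi (0 : ℝ), (f (UpperHalfPlane.ofComplex (Complex.I * y)) *
              (((Real.log (Real.sqrt N * y)) ^ k : ℝ) : ℂ)) *
            ∫ v in Ioi (((N : ℝ) * y)⁻¹), f (UpperHalfPlane.ofComplex (Complex.I * v)) *
              (((Real.log (Real.sqrt N * v)) ^ k : ℝ) : ℂ)) :=
  KMV2000.hasSum_logCutoffW_all

/-- **T5** Rankin's trick on the real form: for all `i j` and `A ≥ 0` there is `C` with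
`|W_{ij}(a₁,a₂;y)| ≤ C · y^{−A} · (1+|a₁|)^i · (1+|a₂|)^j` for all `a₁ a₂` and `y > 0`
(`1_{x₁x₂>y} ≤ (x₁x₂/y)^A`, `∫_0^∞ e^{−x} x^A |a + log x|^i dx ≤ C_{A,i} (1+|a|)^i`). -/
theorem stub_logCutoffW_bound :
    ∀ (i j : ℕ) (A : ℝ), 0 ≤ A → ∃ C : ℝ, ∀ (a₁ a₂ y : ℝ), 0 < y →
      |KMV2000.logCutoffW i j a₁ a₂ y| ≤ C * y ^ (-A) * (1 + |a₁|) ^ i * (1 + |a₂|) ^ j :=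
  KMV2000.logCutoffW_bound_all

/-! ## Composition (kernel-checked; no `sorry` below this line) -/

section Composition

variable {N : ℕ} [NeZero N]

/-- The log-weighted axis function `G_k(y) = f(iy)(log(√N y))^k`. -/
private abbrev G (N : ℕ) (f : CuspForm (Gamma0 N) 2) (k : ℕ) (y : ℝ) : ℂ :=
  f (UpperHalfPlane.ofComplex (Complex.I * y)) * (((Real.log (Real.sqrt N * y)) ^ k : ℝ) : ℂ)

/-- `G_k` is continuous on `(0, ∞)` (holomorphy of `f`, continuity of `log` away from `0`). -/
theorem continuousOn_G (f : CuspForm (Gamma0 N) 2) (k : ℕ) : ContinuousOn (G N f k) (Ioi 0) := by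
  have h1 : ContinuousOn (fun y : ℝ ↦ f (UpperHalfPlane.ofComplex (Complex.I * y))) (Ioi 0) := by
    have hc : ContinuousOn ((f : ℍ → ℂ) ∘ UpperHalfPlane.ofComplex) {z : ℂ | 0 < z.im} :=
      (UpperHalfPlane.mdifferentiable_iff.mp (CuspFormClass.holo f)).continuousOn
    have h2 : ContinuousOn (fun t : ℝ ↦ Complex.I * t) (Ioi 0) := by fun_prop
    exact hc.comp h2 fun t ht ↦ by simpa using ht
  refine h1.mul ?_
  have hN : (0 : ℝ) < Real.sqrt N := Real.sqrt_pos.mpr (by exact_mod_cast NeZero.pos N)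
  refine Complex.continuous_ofReal.comp_continuousOn ((ContinuousOn.pow ?_ k))
  refine (Real.continuousOn_log.comp (by fun_prop) ?_)
  intro y hy
  exact (mul_pos hN hy).ne'

omit [NeZero N] in
/-- `(1/√N)` is the self-dual split point: `(N · (1/√N))⁻¹ = 1/√N`. -/
theorem inv_mul_sqrt_inv : ((N : ℝ) * (Real.sqrt N)⁻¹)⁻¹ = (Real.sqrt N)⁻¹ := by
  have hN : (0 : ℝ) ≤ N := by exact_mod_cast Nat.zero_le N
  rw [mul_inv, inv_inv, inv_mul_eq_div, Real.sqrt_div_self', one_div]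

/-- **`A_k = (−1)^{k+1} ε A_k`** for `A_k = ∫_0^∞ G_k`: split at `1/√N` and flip the upper piece by T2
(`∫_{1/√N}^∞ G_k = (−1)^k(−ε) ∫_0^{1/√N} G_k`), so `A_k = (1 + (−1)^{k+1}ε)X` and `ε² = 1`. -/
theorem integral_G_eq_sign_mul
    (h2 : ∀ (N : ℕ) [NeZero N] (f : CuspForm (Gamma0 N) 2) (ε : ℂ), IsFrickeEigen N f ε →
      ∀ (k : ℕ) (y : ℝ), 0 < y →
        ∫ v in Ioi (((N : ℝ) * y)⁻¹), f (UpperHalfPlane.ofComplex (Complex.I * v)) *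
            (((Real.log (Real.sqrt N * v)) ^ k : ℝ) : ℂ) =
          (-1) ^ k * (-ε) * ∫ u in Ioc (0 : ℝ) y, f (UpperHalfPlane.ofComplex (Complex.I * u)) *
            (((Real.log (Real.sqrt N * u)) ^ k : ℝ) : ℂ))
    (f : CuspForm (Gamma0 N) 2) (k : ℕ) {ε : ℂ} (hW : IsFrickeEigen N f ε) (hε : ε ^ 2 = 1)
    (hint : IntegrableOn (G N f k) (Ioi 0)) :
    (-1) ^ (k + 1) * ε * ∫ y in Ioi (0 : ℝ), G N f k y = ∫ y in Ioi (0 : ℝ), G N f k y := by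
  set b : ℝ := (Real.sqrt N)⁻¹ with hb_def
  have hb : 0 < b := inv_pos.mpr (Real.sqrt_pos.mpr (by exact_mod_cast NeZero.pos N))
  have hsplit : ∫ t in Ioi (0 : ℝ), G N f k t = (∫ t in Ioc 0 b, G N f k t) + ∫ t in Ioi b, G N f k t := by
    have h := intervalIntegral.integral_Ioi_sub_Ioi hint hb.le
    rw [intervalIntegral.integral_of_le hb.le] at h
    linear_combination h
  have hflip : ∫ t in Ioi b, G N f k t = (-1) ^ k * (-ε) * ∫ t in Ioc (0 : ℝ) b, G N f k t := by
    have h := h2 N f ε hW k b hb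
    rw [hb_def, inv_mul_sqrt_inv] at h
    exact h
  have hP : ((-1 : ℂ) ^ k) ^ 2 = 1 := by
    rw [← pow_mul, show k * 2 = 2 * k by ring, pow_mul]
    norm_num
  rw [hsplit, hflip]
  set X : ℂ := ∫ t in Ioc (0 : ℝ) b, G N f k t with hX
  linear_combination (((-1 : ℂ) ^ k) ^ 2 * X) * hε + X * hP

/-- **The identity at every level for Fricke eigenforms**, from the stubs: if `f ∈ S₂(Γ₀(N))`,
`w_N f = ε f`, `ε² = 1`, then for every `k` the real-form double series converges (absolutely) and
`Λ^{(k)}(f,½)² = 2 q̂ Σ' λλ(n₁n₂)^{-1/2} W_{kk}`. -/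
theorem derivLambda_sq_eq_of_fricke
    (h1 : ∀ (N : ℕ) [NeZero N] (f : CuspForm (Gamma0 N) 2) (k : ℕ),
      IntegrableOn (fun y : ℝ ↦ f (UpperHalfPlane.ofComplex (Complex.I * y)) *
          (((Real.log (Real.sqrt N * y)) ^ k : ℝ) : ℂ)) (Ioi 0) ∧
      KMV2000.derivLambda N k f =
        2 * (π : ℂ) * ((KMV2000.qhat N : ℝ) : ℂ) ^ (1 / 2 : ℂ) *
          ∫ y in Ioi (0 : ℝ), f (UpperHalfPlane.ofComplex (Complex.I * y)) *
            (((Real.log (Real.sqrt N * y)) ^ k : ℝ) : ℂ))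
    (h2 : ∀ (N : ℕ) [NeZero N] (f : CuspForm (Gamma0 N) 2) (ε : ℂ), IsFrickeEigen N f ε →
      ∀ (k : ℕ) (y : ℝ), 0 < y →
        ∫ v in Ioi (((N : ℝ) * y)⁻¹), f (UpperHalfPlane.ofComplex (Complex.I * v)) *
            (((Real.log (Real.sqrt N * v)) ^ k : ℝ) : ℂ) =
          (-1) ^ k * (-ε) * ∫ u in Ioc (0 : ℝ) y, f (UpperHalfPlane.ofComplex (Complex.I * u)) *
            (((Real.log (Real.sqrt N * u)) ^ k : ℝ) : ℂ))
    (h4 : ∀ (N : ℕ) [NeZero N] (f : CuspForm (Gamma0 N) 2) (k : ℕ),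
      HasSum (fun n : ℕ × ℕ ↦ GL2Family.heckeLambda f n.1 * GL2Family.heckeLambda f n.2 *
          ((((n.1 : ℝ) * n.2) ^ (-(1 / 2 : ℝ)) : ℝ) : ℂ) *
          ((KMV2000.logCutoffW k k (Real.log (KMV2000.qhat N / n.1)) (Real.log (KMV2000.qhat N / n.2))
            ((n.1 : ℝ) * n.2 / KMV2000.qhat N ^ 2) : ℝ) : ℂ))
        (4 * (π : ℂ) ^ 2 *
          ∫ y in Ioi (0 : ℝ), (f (UpperHalfPlane.ofComplex (Complex.I * y)) *
              (((Real.log (Real.sqrt N * y)) ^ k : ℝ) : ℂ)) *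
            ∫ v in Ioi (((N : ℝ) * y)⁻¹), f (UpperHalfPlane.ofComplex (Complex.I * v)) *
              (((Real.log (Real.sqrt N * v)) ^ k : ℝ) : ℂ)))
    (f : CuspForm (Gamma0 N) 2) {ε : ℂ} (hfr : frickeInvolution N 2 f = ε • f) (hε : ε ^ 2 = 1) (k : ℕ) :
    Summable (fun n : ℕ × ℕ ↦ GL2Family.heckeLambda f n.1 * GL2Family.heckeLambda f n.2 *
          ((((n.1 : ℝ) * n.2) ^ (-(1 / 2 : ℝ)) : ℝ) : ℂ) *
          ((KMV2000.logCutoffW k k (Real.log (KMV2000.qhat N / n.1)) (Real.log (KMV2000.qhat N / n.2))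
            ((n.1 : ℝ) * n.2 / KMV2000.qhat N ^ 2) : ℝ) : ℂ)) ∧
      KMV2000.derivLambda N k f ^ 2 =
        2 * (KMV2000.qhat N : ℂ) * ∑' n : ℕ × ℕ,
          GL2Family.heckeLambda f n.1 * GL2Family.heckeLambda f n.2 *
          ((((n.1 : ℝ) * n.2) ^ (-(1 / 2 : ℝ)) : ℝ) : ℂ) *
          ((KMV2000.logCutoffW k k (Real.log (KMV2000.qhat N / n.1)) (Real.log (KMV2000.qhat N / n.2))
            ((n.1 : ℝ) * n.2 / KMV2000.qhat N ^ 2) : ℝ) : ℂ) := by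
  have hW : IsFrickeEigen N f ε := isFrickeEigen_of_frickeInvolution_eq_smul N hfr
  obtain ⟨hint, hΛ⟩ := h1 N f k
  have hS := h4 N f k
  refine ⟨hS.summable, ?_⟩
  -- the inner tail integral is `(-1)^k (-ε) ∫_{Ioc 0 y} G_k` on `Ioi 0` (T2)
  have hT : ∫ y in Ioi (0 : ℝ), G N f k y *
        ∫ v in Ioi (((N : ℝ) * y)⁻¹), G N f k v =
      (-1) ^ k * (-ε) * ∫ y in Ioi (0 : ℝ), G N f k y * ∫ u in Ioc (0 : ℝ) y, G N f k u := by
    rw [← integral_const_mul]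
    refine setIntegral_congr_fun measurableSet_Ioi fun y hy ↦ ?_
    simp only [G]
    rw [h2 N f ε hW k y hy]
    ring
  -- the head integral (tree FTC lemma with `F := G_k`)
  have hH : ∫ y in Ioi (0 : ℝ), G N f k y * ∫ u in Ioc (0 : ℝ) y, G N f k u =
      (∫ y in Ioi (0 : ℝ), G N f k y) ^ 2 / 2 :=
    KMV2000.integral_Ioi_mul_integral_Ioc_eq_sq_div_two hint (continuousOn_G f k)
  have hA := integral_G_eq_sign_mul h2 f k hW hε hint
  have hsq : (((KMV2000.qhat N : ℝ) : ℂ) ^ (1 / 2 : ℂ)) ^ 2 = (KMV2000.qhat N : ℂ) := by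
    rw [← cpow_nat_mul]
    norm_num
  rw [hS.tsum_eq, hΛ]
  change (2 * (π : ℂ) * ((KMV2000.qhat N : ℝ) : ℂ) ^ (1 / 2 : ℂ) * ∫ y in Ioi (0 : ℝ), G N f k y) ^ 2 =
    2 * (KMV2000.qhat N : ℂ) * (4 * (π : ℂ) ^ 2 *
      ∫ y in Ioi (0 : ℝ), G N f k y * ∫ v in Ioi (((N : ℝ) * y)⁻¹), G N f k v)
  rw [hT, hH, mul_pow, mul_pow, hsq]
  set A : ℂ := ∫ y in Ioi (0 : ℝ), G N f k y with hA_def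
  linear_combination (-4 : ℂ) * (π : ℂ) ^ 2 * (KMV2000.qhat N : ℂ) * A * hA

/-- The summand of (22) IS the real-form summand (T3 on `n₁, n₂ ≥ 1`; both vanish on the axes since
`λ_f(0) = 0`). -/
theorem afeTerm_eq_real
    (h3 : ∀ (qh : ℝ), 0 < qh → ∀ (i j n₁ n₂ : ℕ), n₁ ≠ 0 → n₂ ≠ 0 →
      KMV2000.afeW qh i j n₁ n₂ =
        ((KMV2000.logCutoffW i j (Real.log (qh / n₁)) (Real.log (qh / n₂))
          ((n₁ : ℝ) * n₂ / qh ^ 2) : ℝ) : ℂ))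
    (f : CuspForm (Gamma0 N) 2) (k : ℕ) (n : ℕ × ℕ) :
    KMV2000.afeTerm N f k k n.1 n.2 =
      GL2Family.heckeLambda f n.1 * GL2Family.heckeLambda f n.2 *
          ((((n.1 : ℝ) * n.2) ^ (-(1 / 2 : ℝ)) : ℝ) : ℂ) *
          ((KMV2000.logCutoffW k k (Real.log (KMV2000.qhat N / n.1)) (Real.log (KMV2000.qhat N / n.2))
            ((n.1 : ℝ) * n.2 / KMV2000.qhat N ^ 2) : ℝ) : ℂ) := by
  obtain ⟨n₁, n₂⟩ := n
  by_cases h : n₁ = 0 ∨ n₂ = 0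
  · rw [KMV2000.afeTerm, if_pos h]
    rcases h with h | h
    · simp [h, KMV2000.heckeLambda_zero]
    · simp [h, KMV2000.heckeLambda_zero]
  · have h' := not_or.mp h
    rw [KMV2000.afeTerm, if_neg h, h3 _ (KMV2000.qhat_pos_of_neZero N) k k n₁ n₂ h'.1 h'.2]

/-- **Composition (a)**: the four stubs T1–T4 give the printed all-order fact (22) BY NAME
(newforms have `w_q f = ε_f f`, `ε_f = ±1`: `IsNewform0.frickeInvolution_eq_smul_holds`,
`IsNewform0.frickeEigenvalue_eq_one_or_eq_neg_one_holds`; `Summable ⇔ Summable ‖·‖` in `ℂ`). -/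
theorem kmv2000_eq22_of
    (h1 : ∀ (N : ℕ) [NeZero N] (f : CuspForm (Gamma0 N) 2) (k : ℕ),
      IntegrableOn (fun y : ℝ ↦ f (UpperHalfPlane.ofComplex (Complex.I * y)) *
          (((Real.log (Real.sqrt N * y)) ^ k : ℝ) : ℂ)) (Ioi 0) ∧
      KMV2000.derivLambda N k f =
        2 * (π : ℂ) * ((KMV2000.qhat N : ℝ) : ℂ) ^ (1 / 2 : ℂ) *
          ∫ y in Ioi (0 : ℝ), f (UpperHalfPlane.ofComplex (Complex.I * y)) *
            (((Real.log (Real.sqrt N * y)) ^ k : ℝ) : ℂ))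
    (h2 : ∀ (N : ℕ) [NeZero N] (f : CuspForm (Gamma0 N) 2) (ε : ℂ), IsFrickeEigen N f ε →
      ∀ (k : ℕ) (y : ℝ), 0 < y →
        ∫ v in Ioi (((N : ℝ) * y)⁻¹), f (UpperHalfPlane.ofComplex (Complex.I * v)) *
            (((Real.log (Real.sqrt N * v)) ^ k : ℝ) : ℂ) =
          (-1) ^ k * (-ε) * ∫ u in Ioc (0 : ℝ) y, f (UpperHalfPlane.ofComplex (Complex.I * u)) *
            (((Real.log (Real.sqrt N * u)) ^ k : ℝ) : ℂ))
    (h3 : ∀ (qh : ℝ), 0 < qh → ∀ (i j n₁ n₂ : ℕ), n₁ ≠ 0 → n₂ ≠ 0 →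
      KMV2000.afeW qh i j n₁ n₂ =
        ((KMV2000.logCutoffW i j (Real.log (qh / n₁)) (Real.log (qh / n₂))
          ((n₁ : ℝ) * n₂ / qh ^ 2) : ℝ) : ℂ))
    (h4 : ∀ (N : ℕ) [NeZero N] (f : CuspForm (Gamma0 N) 2) (k : ℕ),
      HasSum (fun n : ℕ × ℕ ↦ GL2Family.heckeLambda f n.1 * GL2Family.heckeLambda f n.2 *
          ((((n.1 : ℝ) * n.2) ^ (-(1 / 2 : ℝ)) : ℝ) : ℂ) *
          ((KMV2000.logCutoffW k k (Real.log (KMV2000.qhat N / n.1)) (Real.log (KMV2000.qhat N / n.2))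
            ((n.1 : ℝ) * n.2 / KMV2000.qhat N ^ 2) : ℝ) : ℂ))
        (4 * (π : ℂ) ^ 2 *
          ∫ y in Ioi (0 : ℝ), (f (UpperHalfPlane.ofComplex (Complex.I * y)) *
              (((Real.log (Real.sqrt N * y)) ^ k : ℝ) : ℂ)) *
            ∫ v in Ioi (((N : ℝ) * y)⁻¹), f (UpperHalfPlane.ofComplex (Complex.I * v)) *
              (((Real.log (Real.sqrt N * v)) ^ k : ℝ) : ℂ))) :
    KMV2000.kmv2000_eq22 := by
  intro q _ _hq f hf k
  have hfr : frickeInvolution q 2 f = frickeEigenvalue f • f :=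
    IsNewform0.frickeInvolution_eq_smul_holds hf
  have hε : frickeEigenvalue f ^ 2 = 1 := by
    rcases IsNewform0.frickeEigenvalue_eq_one_or_eq_neg_one_holds (N := q) (k := (2 : ℤ)) hf with
      h | h <;> rw [h] <;> norm_num
  obtain ⟨hsum, heq⟩ := derivLambda_sq_eq_of_fricke h1 h2 h4 f hfr hε k
  have hfun : (fun n : ℕ × ℕ ↦ KMV2000.afeTerm q f k k n.1 n.2) =
      fun n : ℕ × ℕ ↦ GL2Family.heckeLambda f n.1 * GL2Family.heckeLambda f n.2 *
          ((((n.1 : ℝ) * n.2) ^ (-(1 / 2 : ℝ)) : ℝ) : ℂ) *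
          ((KMV2000.logCutoffW k k (Real.log (KMV2000.qhat q / n.1)) (Real.log (KMV2000.qhat q / n.2))
            ((n.1 : ℝ) * n.2 / KMV2000.qhat q ^ 2) : ℝ) : ℂ) :=
    funext (afeTerm_eq_real h3 f k)
  refine ⟨?_, ?_⟩
  · exact (summable_norm_iff.mpr hsum).congr fun n ↦ by rw [afeTerm_eq_real h3 f k n]
  · rw [hfun]
    exact heq

/-- **Composition (b)**: the bridge T3 and Rankin's bound T5 give the decay statement BY NAME
(`‖W_{ij}‖ = |W_{ij}|`, `y^{−A} = (q̂²/n₁n₂)^A` for `y = n₁n₂/q̂²`). -/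
theorem afeW_decay_of
    (h3 : ∀ (qh : ℝ), 0 < qh → ∀ (i j n₁ n₂ : ℕ), n₁ ≠ 0 → n₂ ≠ 0 →
      KMV2000.afeW qh i j n₁ n₂ =
        ((KMV2000.logCutoffW i j (Real.log (qh / n₁)) (Real.log (qh / n₂))
          ((n₁ : ℝ) * n₂ / qh ^ 2) : ℝ) : ℂ))
    (h5 : ∀ (i j : ℕ) (A : ℝ), 0 ≤ A → ∃ C : ℝ, ∀ (a₁ a₂ y : ℝ), 0 < y →
      |KMV2000.logCutoffW i j a₁ a₂ y| ≤ C * y ^ (-A) * (1 + |a₁|) ^ i * (1 + |a₂|) ^ j) :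
    KMV2000.afeW_decay := by
  intro i j A hA
  obtain ⟨C, hC⟩ := h5 i j A hA
  refine ⟨C, fun qh hqh n₁ n₂ hn₁ hn₂ ↦ ?_⟩
  have h₁ : (0 : ℝ) < n₁ := by exact_mod_cast Nat.pos_of_ne_zero hn₁
  have h₂ : (0 : ℝ) < n₂ := by exact_mod_cast Nat.pos_of_ne_zero hn₂
  have hy : 0 < (n₁ : ℝ) * n₂ / qh ^ 2 := by positivity
  rw [h3 qh hqh i j n₁ n₂ hn₁ hn₂, Complex.norm_real, Real.norm_eq_abs]
  have hpow : ((n₁ : ℝ) * n₂ / qh ^ 2) ^ (-A) = (qh ^ 2 / ((n₁ : ℝ) * n₂)) ^ A := by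
    rw [Real.rpow_neg hy.le, ← Real.inv_rpow hy.le, inv_div]
  have h := hC (Real.log (qh / n₁)) (Real.log (qh / n₂)) _ hy
  rwa [hpow] at h

/-- The fact (a) from the stubs, BY NAME. -/
theorem kmv2000_eq22_of_stubs : KMV2000.kmv2000_eq22 :=
  kmv2000_eq22_of stub_derivLambda_eq_integral stub_fricke_tail_log stub_afeW_eq_logCutoffW
    stub_hasSum_logCutoffW

/-- The fact (b) from the stubs, BY NAME. -/
theorem afeW_decay_of_stubs : KMV2000.afeW_decay :=
  afeW_decay_of stub_afeW_eq_logCutoffW stub_logCutoffW_bound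

end Composition

end Literature.NumberTheory.LFunctions.KMV2000.LogFrickeSplit

end
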